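import Literature.Claims.NS.ClayVariants
import Literature.Analysis.FunctionSpaces.FourierSobolevNorm
import Literature.Analysis.FunctionSpaces.Complexify
import Literature.Analysis.FluidPDE.ClassicalSolution
import Literature.Analysis.FluidPDE.VectorCalculus
import Literature.Analysis.FluidPDE.NSLerayHopf
import HarnessLib

/-!
# Claim skeleton: Nguyen (2022), «The regularity of global-in-time solutions to Navier-Stokes
# equations without external force»

Cell `ns-claims` (D-0090 NS-CLAIMS SWEEP), claim C75, typist `ns-claims-typist-9` (lead re-point
2026-08-26T19:57Z). UNREFEREED/DISPUTED CLAIM under adjudication — NOTHING in this file asserts a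
step: every `Step…` declaration is a `Prop` (the paper's assertion or asserted implication, typed
concretely so that its negation or its vacuity can be a kernel theorem in
`Summits/NavierStokesRegularity/NavierStokesRegularity/Theorems/SoloRefuteNguyen2022.lean`); the
`theorem`s are unfolding lemmas and the kernel COMPOSITIONS of the paper's own implications.

Version of record: Vu Thanh Nguyen, arXiv:2004.08239 **v8** [math.AP], 5 Apr 2022, 24 pp. — the latest
version carrying the claim (v7, 19 Feb 2022, is the same text in substance; v1–v6 (2020–2021) do not
contain §3's monotonicity argument nor the full claim; **v9 (24 Jul 2023) retreats** to local strong
solutions on bounded domains and removes §3 and the global claim). Bib key `Nguyen2022NSGlobalNoForce`.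
Print page = arXiv v8 PDF page; TeX lines = `pub/ns-claims/sources/Nguyen2022/arxiv-2004.08239/v8.tex`;
page renders `…/v8-pages/p001–p024.txt`; locators `sources/Nguyen2022/LOCATORS.md` (ns-claims-lit-2).

## Claimed statement (as printed)

Theorem 1.0.1, p. 2 (TeX l.141–173): «Let Ω = ℝ³. Assume that (1.0.2) u₀ ∈ closure of
C^∞_{c,σ}(ℝ³) in ‖·‖_{H^m(ℝ³)} for every m ∈ ℕ. Then, there exist functions u, p satisfying
• (1.0.3) ∂ₜu − νΔu = −(u·∇)u − ∇p, ∀(x,t) ∈ ℝ³×[0,+∞); • (1.0.4) div u = 0; • (1.0.5) u(·,0) = u₀;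
• (1.0.6) u ∈ C^∞(ℝ³×[0,+∞))³, p ∈ C^∞(ℝ³×[0,+∞)); • (1.0.7) the existence of u is unique;
• (1.0.8) the existence of p is unique up to a constant. Furthermore, u satisfies (1.0.9): the function
t ↦ ‖u(·,t)‖_{H¹(ℝ³)} is non-increasing on [0,+∞).» Typed: `ClaimedTheorem` (all ν > 0; (1.0.7) in
the class in which §4 proves it, (4.0.10) «u is a unique global strong solution»: classical solutions
with locally bounded H¹ norm; (1.0.8) as «up to an additive constant at each time»).

## Clay delta (reference `ClayVariants.lean`)

Nearest: (A) = `ClayVariants.clayR3.Regularity`. Axes: Δ1 domain ℝ³ = · Δ2 NS, every ν > 0 = · Δ3 force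
≡ 0 = · Δ4 DATA CLASS (1.0.2) ⊇ Clay data (4) (a rapidly decaying smooth divergence-free field is in the
H^m-closure of C^∞_{c,σ} for every m, and has finite H¹ norm — classical density/integrability facts,
typed as `ClayDelta`) · Δ5 solution class C^∞(ℝ³×[0,∞)) = (6); (7) bounded energy follows from (1.0.9) ·
Δ6 global = · Δ7/Δ8 —. `clay_of_claimed_of_delta : ClayDelta → ClaimedTheorem → clayR3.Regularity`
is PROVED (bridge `isNavierStokesSolution_and_smooth_iff`). Not a «wrong problem» candidate.

## Steps (paper item · print page · TeX lines · typist's private flag)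

The paper's logic (p. 2 l.176–180; p. 20 Remark 3.0.3; §4 p. 20–23): §3 Theorem 3.0.1 (an inference
between the two scalar functions E(t) = ‖u‖₂², Z(t) = ‖∇u‖₂² from the displayed relations (3.0.1)
alone) ⇒ Corollary 3.0.2 (every Galerkin approximation has non-increasing H¹ norm) ⇒ (4.0.6) uniform
L^∞ₜH¹ bounds ⇒ Theorem 2.3.8 (global strong solution) ⇒ §4 Steps B–C (smoothness up to t = 0,
uniqueness) and «By Remark 3.0.3-(1), one gets (1.0.9)». Ordered index (TYPING-HYGIENE 11, 13):
* Step 1 = `Step1_PhiDecreasing` — proof of Thm 3.0.1, Step 1, (3.0.6)–(3.0.8), pp. 17–18 (l.1453–1507),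
  at the scalar grain the proof computes in — plausible (calculus; support).
* Step 2 = `Step2_RescaledInequality` — (3.0.9)–(3.0.10), p. 19 (l.1510–1539), with the auxiliary
  `m` of (3.0.6) written out through (3.0.4): m = λ·C₀b/(2C₁‖u(t₁)‖₂²) — plausible given Step 1 (support).
* Step 3 = `Step3_LambdaLimit` — p. 19 (l.1541–1549) «Passing to the limit as λ → 0, one obtains
  (0 + m/‖∇u(t₁)‖₂²)/(0 + m/‖∇u(t)‖₂²) ≤ [‖u(t₁)‖₂²/‖u(t)‖₂²]^b»: the asserted inference from (3.0.10)
  (all λ ∈ (0,1)) with m as defined in (3.0.6) — SUSPICIOUS (m = λ·m₀, so (3.0.10) is λ-free); twin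
  `Step3_LambdaLimit_mConst` = the same inference for a λ-INDEPENDENT m (the reading under which the
  printed limit is valid; not what (3.0.6) defines) — true-looking. Support (mechanism) for Step 5.
* Step 4 = `Step4_bLimit` — p. 19 (l.1553–1562) «Passing to the limit as b → 0» — plausible (support).
* Step 5 = `Step5_Theorem301` — Theorem 3.0.1, p. 17 (l.1388–1406), AS PRINTED (any u : Ω×[0,T) → ℝ³,
  any domain Ω, through E, Z only) — SUSPICIOUS; LOAD-BEARING (consumed by Cor 3.0.2, Rem 3.0.3, §4
  Step A, (1.0.9)); abstract twin `Step5_Theorem301_scalar` (F15 grain: arbitrary positive scalar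
  functions E, Z).
* Step 6 = `Step6_Section4` — §4 Steps A–C, pp. 20–23 (l.1630–1866), with Cor 3.0.2 p. 20, (4.0.5)–(4.0.6)
  p. 21, Thm 2.3.8 p. 13, Lemma 2.2.3 pp. 3–4: the asserted implication «Theorem 3.0.1 ⇒ for every datum of
  class (1.0.2) a global solution with (1.0.3)–(1.0.8)» — plausible GIVEN Theorem 3.0.1 (Galerkin
  compactness, parabolic regularity up to t = 0 for H^∞ data, uniqueness of strong solutions); CONSUMED.
* Step 7 = `Step7_StrongSolutionLaws` — Remark 3.0.3 (1), p. 20 (l.1615) with Lemma 2.2.3 (2.2.10)–(2.2.11)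
  p. 4 (l.323–329): a global smooth solution with locally bounded H¹ norm satisfies (3.0.1) with
  C₀ = 2ν and some C₁ (energy equality, enstrophy inequality; Robinson–Rodrigo–Sadowski Ch. 6 as cited)
  — classical; CONSUMED (it feeds Step 5 to give (1.0.9), p. 23 l.1868).

## COMPOSITION — proved as `claim_of_steps`

`claim_of_steps : Step1 → … → Step7 → ClaimedTheorem` — PROVED (short logic); it consumes Steps 5, 6, 7:
Step 6 applied to Step 5 gives (u, p) with (1.0.3)–(1.0.8); Step 7 gives (3.0.1) for this u on every
[0,T); Step 5 (Ω = ℝ³) gives (3.0.2) on every [0,T), whence (1.0.9). Steps 1–4 are the printed proof of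
Step 5 (support, underscored); their scalar chain is recorded as `theorem301_scalar_of_steps :
Step1 → Step2 → Step3 → Step4 → Step5_Theorem301_scalar` (PROVED: the printed proof composes AT THE
SCALAR GRAIN once Step 3 is granted). The paper's logic COMPOSES; the adjudication is about the truth
of Step 5 (mechanism: Step 3), p. 17 / p. 19.

## Design / conventions

* Physical space `EuclideanSpace ℝ (Fin 3)`; solutions are the tree's `IsClassicalNSSolutionOn S ν 0 u p`
  (jointly C^∞ on S × ℝ³, momentum + incompressibility pointwise); E(t) = `energyOn Ω (u t)` =
  ∫_Ω ‖u‖² and Z(t) = `enstrophyOn Ω (u t)` = ∫_Ω |∇u|²_F (Frobenius, the tree's `frobeniusNormSq`),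
  both in `ℝ≥0∞`; the scalar functions of Theorem 3.0.1 are their `toReal`, with finiteness hypotheses.
* «differentiable on [0,T)» = `HasDerivWithinAt _ _ (Set.Ico 0 T) t` at every t ∈ [0,T) (two-sided
  inside, one-sided at 0).
* The data class (1.0.2) is typed literally (`DataClass`: H^m-approximability by C^∞_{c,σ} fields for
  every m, with the tree's Fourier-side `Function.eSobolevNorm`).
* Quantifier order (F11): in Theorem 3.0.1 the constants C₀, C₁ are given WITH u («do not depend on T»);
  typed as universally quantified positive reals (the proof uses C₀, C₁ > 0: m > 0, division by C₁).

WHAT THIS IS NOT: not a claim about NS regularity or blow-up; not a claim about any author beyond the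
typed locator.
-/

open MeasureTheory Set Filter
open scoped ENNReal Topology

namespace Literature.Claims.NS.Nguyen2022

open Literature.Analysis.FluidPDE Literature.Analysis.FunctionSpaces
open Literature.Analysis.FunctionSpaces.EuclideanSpace (complexify)

noncomputable section

/-! ## §A. Vocabulary (definitions with bodies; nothing asserted) -/

/-- `‖v‖²_{L²(Ω)} = ∫_Ω ‖v(x)‖² dx ∈ ℝ≥0∞` (p. 2 notations; the paper's `‖·‖₂` on Ω).
[cite: Nguyen2022NSGlobalNoForce, §2.1 p. 2] -/
def energyOn (Ω : Set (EuclideanSpace ℝ (Fin 3)))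
    (v : EuclideanSpace ℝ (Fin 3) → EuclideanSpace ℝ (Fin 3)) : ℝ≥0∞ :=
  ∫⁻ x in Ω, ‖v x‖ₑ ^ 2

/-- `‖∇v‖²_{L²(Ω)} = ∫_Ω |∇v(x)|² dx ∈ ℝ≥0∞`, with the Frobenius norm `|∇v|² = ∑ᵢⱼ(∂ᵢvⱼ)²` of the
Fréchet derivative (the tree's `frobeniusNormSq`; junk `fderiv = 0` where `v` is not differentiable).
[cite: Nguyen2022NSGlobalNoForce, §2.1 p. 2; §3 p. 17] -/
def enstrophyOn (Ω : Set (EuclideanSpace ℝ (Fin 3)))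
    (v : EuclideanSpace ℝ (Fin 3) → EuclideanSpace ℝ (Fin 3)) : ℝ≥0∞ :=
  ∫⁻ x in Ω, ENNReal.ofReal (frobeniusNormSq (fderiv ℝ v x))

/-- `‖v‖²_{H¹(ℝ³)} = ‖v‖₂² + ‖∇v‖₂²` on the whole space. [cite: Nguyen2022NSGlobalNoForce, §2.1 p. 2] -/
def h1Sq (v : EuclideanSpace ℝ (Fin 3) → EuclideanSpace ℝ (Fin 3)) : ℝ≥0∞ :=
  energyOn Set.univ v + enstrophyOn Set.univ v

/-- The data class (1.0.2), p. 2 (l.143–147): `u₀` lies in the `H^m(ℝ³)`-closure of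
`C^∞_{c,σ}(ℝ³) = {v ∈ C^∞_c(ℝ³)³ : div v = 0}` for EVERY `m ∈ ℕ` — typed literally: for every `m` and
`ε > 0` there is a smooth compactly supported divergence-free `φ` with `‖u₀ − φ‖_{H^m} < ε` (the tree's
Fourier-side inhomogeneous norm `Function.eSobolevNorm m`, real fields complexified componentwise).
[cite: Nguyen2022NSGlobalNoForce, Thm 1.0.1 eq. (1.0.2) p. 2] -/
def DataClass (u₀ : EuclideanSpace ℝ (Fin 3) → EuclideanSpace ℝ (Fin 3)) : Prop :=
  ∀ m : ℕ, ∀ ε : ℝ, 0 < ε →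
    ∃ φ : EuclideanSpace ℝ (Fin 3) → EuclideanSpace ℝ (Fin 3),
      ContDiff ℝ ((⊤ : ℕ∞) : WithTop ℕ∞) φ ∧ HasCompactSupport φ ∧ NSWave0.IsDivFree φ ∧
        Function.eSobolevNorm (m : ℝ) (complexify ∘ (u₀ - φ)) < ENNReal.ofReal ε

/-- The two displayed relations (3.0.1), p. 17 (l.1390–1398), for a field `u` on `Ω × [0,T)` with
constants `C₀, C₁`: `t ↦ ‖u‖²_{L²(Ω)}` and `t ↦ ‖∇u‖²_{L²(Ω)}` are finite and differentiable on `[0,T)`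
with `d/dt ‖u(·,t)‖²_{L²(Ω)} = −C₀‖∇u(·,t)‖²_{L²(Ω)}` and `d/dt ‖∇u(·,t)‖²_{L²(Ω)} ≤ C₁‖∇u(·,t)‖⁶_{L²(Ω)}`
for all `t ∈ [0,T)` (derivatives within `[0,T)`; `T = ⊤` allowed).
[cite: Nguyen2022NSGlobalNoForce, Thm 3.0.1 eq. (3.0.1) p. 17] -/
def Laws301 (Ω : Set (EuclideanSpace ℝ (Fin 3))) (T : ℝ≥0∞) (C₀ C₁ : ℝ)
    (u : ℝ → EuclideanSpace ℝ (Fin 3) → EuclideanSpace ℝ (Fin 3)) : Prop :=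
  ∀ t : ℝ, 0 ≤ t → ENNReal.ofReal t < T →
    energyOn Ω (u t) ≠ ∞ ∧ enstrophyOn Ω (u t) ≠ ∞ ∧
      HasDerivWithinAt (fun s => (energyOn Ω (u s)).toReal)
        (-C₀ * (enstrophyOn Ω (u t)).toReal) {s : ℝ | 0 ≤ s ∧ ENNReal.ofReal s < T} t ∧
      ∃ z' : ℝ, HasDerivWithinAt (fun s => (enstrophyOn Ω (u s)).toReal) z'
          {s : ℝ | 0 ≤ s ∧ ENNReal.ofReal s < T} t ∧
        z' ≤ C₁ * (enstrophyOn Ω (u t)).toReal ^ 3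

/-- The conclusion (3.0.2), p. 17 (l.1400–1405): `t ↦ ‖u(·,t)‖²_{H¹(Ω)} = ‖u‖²_{L²(Ω)} + ‖∇u‖²_{L²(Ω)}` is
non-increasing on `[0,T)`. [cite: Nguyen2022NSGlobalNoForce, Thm 3.0.1 eq. (3.0.2) p. 17] -/
def Monotone302 (Ω : Set (EuclideanSpace ℝ (Fin 3))) (T : ℝ≥0∞)
    (u : ℝ → EuclideanSpace ℝ (Fin 3) → EuclideanSpace ℝ (Fin 3)) : Prop :=
  AntitoneOn (fun t => energyOn Ω (u t) + enstrophyOn Ω (u t)) {t : ℝ | 0 ≤ t ∧ ENNReal.ofReal t < T}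

/-- The scalar form of (3.0.1) for two real functions `E, Z` on `[0,T)` (the grain at which the proof
of Theorem 3.0.1 computes): positivity (the proof's WLOG, p. 17 l.1411–1412), `E′ = −C₀Z`, `Z′ ≤ C₁Z³`
within `[0,T)`. [cite: Nguyen2022NSGlobalNoForce, Thm 3.0.1 eq. (3.0.1) and proof p. 17] -/
def ScalarLaws (T C₀ C₁ : ℝ) (E Z : ℝ → ℝ) : Prop :=
  ∀ t ∈ Set.Ico (0 : ℝ) T,
    0 < E t ∧ 0 < Z t ∧ HasDerivWithinAt E (-C₀ * Z t) (Set.Ico 0 T) t ∧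
      ∃ z' : ℝ, HasDerivWithinAt Z z' (Set.Ico 0 T) t ∧ z' ≤ C₁ * Z t ^ 3

/-- The auxiliary function `φ` of (3.0.7), p. 18 (l.1464–1469), at the scalar grain:
`φ(t) = E(t)^b / (1 + m / Z(t))`. [cite: Nguyen2022NSGlobalNoForce, eq. (3.0.7) p. 18] -/
def phi (b m : ℝ) (E Z : ℝ → ℝ) (t : ℝ) : ℝ :=
  E t ^ b / (1 + m / Z t)

/-! ## §B. The claimed statement and its Clay link -/

/-- «The existence of u is unique» (1.0.7), p. 2, in the class in which §4 obtains it ((4.0.10),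
p. 21 l.1718: «u is a unique global strong solution»): any classical solution on ℝ³ × [0,∞) from the
same datum whose H¹ norm is bounded on every compact time interval coincides with `u`.
[cite: Nguyen2022NSGlobalNoForce, Thm 1.0.1 (1.0.7) p. 2; (4.0.10) p. 21] -/
def UniqueInStrongClass (ν : ℝ) (u₀ : EuclideanSpace ℝ (Fin 3) → EuclideanSpace ℝ (Fin 3))
    (u : ℝ → EuclideanSpace ℝ (Fin 3) → EuclideanSpace ℝ (Fin 3)) : Prop :=
  ∀ (v : ℝ → EuclideanSpace ℝ (Fin 3) → EuclideanSpace ℝ (Fin 3)) (q : ℝ → EuclideanSpace ℝ (Fin 3) → ℝ),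
    IsClassicalNSSolutionOn (Set.Ici 0) ν 0 v q → v 0 = u₀ →
      (∀ T : ℝ, 0 < T → ∃ C : ℝ≥0∞, C < ∞ ∧ ∀ t ∈ Set.Icc 0 T, h1Sq (v t) ≤ C) →
        ∀ t : ℝ, 0 ≤ t → v t = u t

/-- «The existence of p is unique up to a constant» (1.0.8), p. 2 (proof p. 23 l.1856–1866:
`∇(p₂ − p₁) = 0`): any pressure `q` making `(u, q)` a classical solution differs from `p` at each time
`t ≥ 0` by an additive constant. [cite: Nguyen2022NSGlobalNoForce, Thm 1.0.1 (1.0.8) p. 2; p. 23] -/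
def PressureUniqueUpToConstant (ν : ℝ) (u : ℝ → EuclideanSpace ℝ (Fin 3) → EuclideanSpace ℝ (Fin 3))
    (p : ℝ → EuclideanSpace ℝ (Fin 3) → ℝ) : Prop :=
  ∀ q : ℝ → EuclideanSpace ℝ (Fin 3) → ℝ, IsClassicalNSSolutionOn (Set.Ici 0) ν 0 u q →
    ∀ t : ℝ, 0 ≤ t → ∃ c : ℝ, ∀ x, q t x = p t x + c

/-- The conclusions (1.0.3)–(1.0.9) of Theorem 1.0.1, p. 2, for one viscosity and one datum:
a pair `(u, p)` jointly C^∞ on ℝ³ × [0,∞) solving the unforced system there with `u(·,0) = u₀`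
((1.0.3)–(1.0.6) = the tree's `IsClassicalNSSolutionOn (Ici 0)`), `u` unique (1.0.7), `p` unique up to
constants (1.0.8), and `t ↦ ‖u(·,t)‖_{H¹(ℝ³)}` non-increasing on [0,∞) (1.0.9) (typed on the squared norm,
equivalent). [cite: Nguyen2022NSGlobalNoForce, Thm 1.0.1 (1.0.3)–(1.0.9) p. 2] -/
def Conclusion101 (ν : ℝ) (u₀ : EuclideanSpace ℝ (Fin 3) → EuclideanSpace ℝ (Fin 3))
    (u : ℝ → EuclideanSpace ℝ (Fin 3) → EuclideanSpace ℝ (Fin 3)) (p : ℝ → EuclideanSpace ℝ (Fin 3) → ℝ) :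
    Prop :=
  IsClassicalNSSolutionOn (Set.Ici 0) ν 0 u p ∧ u 0 = u₀ ∧ UniqueInStrongClass ν u₀ u ∧
    PressureUniqueUpToConstant ν u p ∧ AntitoneOn (fun t => h1Sq (u t)) (Set.Ici 0)

/-- **The claimed theorem, as printed** (Theorem 1.0.1, p. 2; abstract p. 1): for every viscosity
`ν > 0` («ν» is the fixed positive viscosity of (1.0.1)) and every datum `u₀` of class (1.0.2) there
exist `u, p` with (1.0.3)–(1.0.9). [cite: Nguyen2022NSGlobalNoForce, Thm 1.0.1 p. 2] -/
def ClaimedTheorem : Prop :=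
  ∀ ν : ℝ, 0 < ν →
    ∀ u₀ : EuclideanSpace ℝ (Fin 3) → EuclideanSpace ℝ (Fin 3), DataClass u₀ →
      ∃ (u : ℝ → EuclideanSpace ℝ (Fin 3) → EuclideanSpace ℝ (Fin 3))
        (p : ℝ → EuclideanSpace ℝ (Fin 3) → ℝ), Conclusion101 ν u₀ u p

/-- **Clay delta** (TYPING-HYGIENE 10 (b); axis Δ4 DATA CLASS of `ClayVariants.lean` §3): the classical
facts under which Theorem 1.0.1 decides Clay (A) — a Clay datum (smooth, divergence free, rapidly
decaying (4)) belongs to the class (1.0.2) (density of C^∞_{c,σ} in H^m ∩ {div = 0}) and has finite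
H¹ norm. Not claims of the paper. [cite: FeffermanClay2006, (A) with (4), p. 2] -/
def ClayDelta : Prop :=
  ∀ u₀ : EuclideanSpace ℝ (Fin 3) → EuclideanSpace ℝ (Fin 3),
    ContDiff ℝ ((⊤ : ℕ∞) : WithTop ℕ∞) u₀ → NSWave0.IsDivFree u₀ → HasRapidSpatialDecay u₀ →
      DataClass u₀ ∧ h1Sq u₀ < ∞

/-- Under `ClayDelta`, the claimed theorem implies Clay (A) (`ClayVariants.clayR3.Regularity`):
(1.0.3)–(1.0.6) are Fefferman's (1)(2)(3)(6) by the tree's bridge `isNavierStokesSolution_and_smooth_iff`,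
and (7) bounded energy follows from (1.0.9): `∫‖u(t)‖² ≤ ‖u(t)‖²_{H¹} ≤ ‖u₀‖²_{H¹} < ∞`.
[cite: FeffermanClay2006, (A) p. 2] -/
theorem clay_of_claimed_of_delta (hΔ : ClayDelta) (hC : ClaimedTheorem) :
    ClayVariants.clayR3.Regularity := by
  intro ν hν u₀ hsmooth hdiv hdecay
  obtain ⟨hdata, hfin⟩ := hΔ u₀ hsmooth hdiv hdecay
  obtain ⟨u, p, hcl, h0, -, -, hmono⟩ := hC ν hν u₀ hdata
  obtain ⟨hns, hsu, hsp⟩ := (isNavierStokesSolution_and_smooth_iff (ν := ν) (f := 0) (u₀ := u₀)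
    (u := u) (p := p)).mpr ⟨hcl, h0⟩
  refine ⟨u, p, hsu, hsp, hns, ?_⟩
  refine ⟨h1Sq u₀, hfin, fun t ht => ?_⟩
  have hmem0 : (0 : ℝ) ∈ Set.Ici (0 : ℝ) := Set.mem_Ici.mpr le_rfl
  have hle : h1Sq (u t) ≤ h1Sq (u 0) := hmono hmem0 (Set.mem_Ici.mpr ht) ht
  rw [h0] at hle
  calc ∫⁻ x, ‖u t x‖ₑ ^ 2 = energyOn Set.univ (u t) := by simp [energyOn]
    _ ≤ h1Sq (u t) := le_self_add
    _ ≤ h1Sq u₀ := hle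

/-! ## §C. The steps -/

/-- **Step 1 — proof of Theorem 3.0.1, Step 1 «Proof of the decreasing property of φ»,
(3.0.6)–(3.0.8), pp. 17–18 (l.1453–1507), at the scalar grain the computation uses.** For scalar
functions `E, Z` obeying (3.0.1) (with `C₀, C₁ > 0`, `E, Z > 0`) on an interval `[t₁, T′)`, and
«• b > 0; • ‖ũ₁‖ := ‖ũ(·,t₁)‖; • m := C₀b/(2C₁‖ũ₁‖²)», the function `φ(t) = E(t)^b/(1 + m/Z(t))` is
decreasing on `[t₁, T′)`. (In the paper this is applied to the rescaled `ũ` of (3.0.3), whose `Ẽ, Z̃`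
obey the same relations (3.0.5) with the same constants; the computation l.1471–1501 is this scalar
statement.) Typist's flag: plausible (φ′ ≤ E^{b−1} Z (1+m/Z)^{−1} [−C₀b + C₁ m E(t₁)] = −½C₀b·(…) < 0).
[cite: Nguyen2022NSGlobalNoForce, proof of Thm 3.0.1 Step 1, (3.0.6)–(3.0.8) pp. 17–18] -/
def Step1_PhiDecreasing : Prop :=
  ∀ (t₁ T' C₀ C₁ b : ℝ) (E Z : ℝ → ℝ), t₁ < T' → 0 < C₀ → 0 < C₁ → 0 < b →
    (∀ t ∈ Set.Ico t₁ T',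
      0 < E t ∧ 0 < Z t ∧ HasDerivWithinAt E (-C₀ * Z t) (Set.Ico t₁ T') t ∧
        ∃ z' : ℝ, HasDerivWithinAt Z z' (Set.Ico t₁ T') t ∧ z' ≤ C₁ * Z t ^ 3) →
    StrictAntiOn (phi b (C₀ * b / (2 * C₁ * E t₁)) E Z) (Set.Ico t₁ T')

/-- **Step 2 — proof Step 2, (3.0.9)–(3.0.10), p. 19 (l.1510–1539), with the rescaling (3.0.3)–(3.0.4),
p. 17–18.** From φ(t₁ + λ⁻²(t − t₁)) ≤ φ(t₁) for the rescaled field and «By (3.0.4)»: for every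
`λ ∈ (0,1)`, `b > 0` and `t ∈ [t₁,T)`, (3.0.10)
`(λ + m/‖∇u(t₁)‖₂²)/(λ + m/‖∇u(t)‖₂²) ≤ [‖u(t₁)‖₂²/‖u(t)‖₂²]^b`, where — (3.0.6) with (3.0.4) at t = t₁,
`‖ũ₁‖²_{L²(λ⁻¹Ω)} = λ⁻¹‖u(t₁)‖₂²` — `m = C₀b/(2C₁λ⁻¹‖u(t₁)‖₂²) = λ·C₀b/(2C₁‖u(t₁)‖₂²)`. Scalar grain.
Typist's flag: plausible given Step 1. [cite: Nguyen2022NSGlobalNoForce, (3.0.3)–(3.0.4) p. 17–18; (3.0.9)–(3.0.10) p. 19] -/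
def Step2_RescaledInequality : Prop :=
  ∀ (T C₀ C₁ : ℝ) (E Z : ℝ → ℝ), 0 < T → 0 < C₀ → 0 < C₁ → ScalarLaws T C₀ C₁ E Z →
    ∀ t₁ ∈ Set.Ico (0 : ℝ) T, ∀ t ∈ Set.Ico t₁ T, ∀ b : ℝ, 0 < b → ∀ lam : ℝ, 0 < lam → lam < 1 →
      (lam + lam * (C₀ * b / (2 * C₁ * E t₁)) / Z t₁) / (lam + lam * (C₀ * b / (2 * C₁ * E t₁)) / Z t) ≤
        (E t₁ / E t) ^ b

/-- **Step 3 — «Passing to the limit as λ → 0, one obtains (0 + m/‖∇u(t₁)‖₂²)/(0 + m/‖∇u(t)‖₂²) ≤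
[‖u(t₁)‖₂²/‖u(t)‖₂²]^b, i.e. ‖∇u(t)‖₂²/‖∇u₁‖₂² ≤ [‖u₁‖₂²/‖u(t)‖₂²]^b», p. 19 (l.1541–1549):** the
asserted inference, for positive reals `Z₁ = ‖∇u(t₁)‖₂²`, `Z = ‖∇u(t)‖₂²`, `E₁ = ‖u(t₁)‖₂²`,
`E = ‖u(t)‖₂²`, `b`, `C₀`, `C₁`, from (3.0.10) for all `λ ∈ (0,1)` WITH `m` AS DEFINED IN (3.0.6)
(`m = λ·C₀b/(2C₁E₁)`, see Step 2) to `Z/Z₁ ≤ (E₁/E)^b`. Typist's flag: SUSPICIOUS — with this `m` the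
left side of (3.0.10) does not depend on λ (it equals (1 + m₀/Z₁)/(1 + m₀/Z), m₀ = C₀b/(2C₁E₁)), so
the hypothesis carries no limit information; cf. `Step3_LambdaLimit_mConst`.
[cite: Nguyen2022NSGlobalNoForce, proof of Thm 3.0.1 Step 2, «Passing to the limit as λ → 0», p. 19] -/
def Step3_LambdaLimit : Prop :=
  ∀ (Z₁ Z E₁ E b C₀ C₁ : ℝ), 0 < Z₁ → 0 < Z → 0 < E₁ → 0 < E → 0 < b → 0 < C₀ → 0 < C₁ →
    (∀ lam : ℝ, 0 < lam → lam < 1 →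
      (lam + lam * (C₀ * b / (2 * C₁ * E₁)) / Z₁) / (lam + lam * (C₀ * b / (2 * C₁ * E₁)) / Z) ≤
        (E₁ / E) ^ b) →
    Z / Z₁ ≤ (E₁ / E) ^ b

/-- **Step 3′ — the λ-constant reading of the same passage (charitable twin; NOT what (3.0.6) defines):**
if `m > 0` does NOT depend on λ, then (3.0.10) for all `λ ∈ (0,1)` does give, as λ → 0,
`(m/Z₁)/(m/Z) = Z/Z₁ ≤ (E₁/E)^b`. Recorded so that the referee's charitable retype has a kernel target:
under this reading the limit is valid and the break moves to Step 2 (whose `m` is then not the printed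
one). Typist's flag: true-looking (continuity of λ ↦ (λ + a)/(λ + c) at 0).
[cite: Nguyen2022NSGlobalNoForce, proof of Thm 3.0.1 Step 2, p. 19] -/
def Step3_LambdaLimit_mConst : Prop :=
  ∀ (Z₁ Z m r : ℝ), 0 < Z₁ → 0 < Z → 0 < m →
    (∀ lam : ℝ, 0 < lam → lam < 1 → (lam + m / Z₁) / (lam + m / Z) ≤ r) → Z / Z₁ ≤ r

/-- **Step 4 — «Passing to the limit as b → 0, one obtains ‖∇u(t)‖₂²/‖∇u(t₁)‖₂² ≤ 1», p. 19
(l.1553–1562):** for positive reals, `[∀ b > 0, Z/Z₁ ≤ (E₁/E)^b] ⇒ Z ≤ Z₁`. Typist's flag: plausible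
(limit of (E₁/E)^b as b → 0⁺ is 1). [cite: Nguyen2022NSGlobalNoForce, proof of Thm 3.0.1 Step 2, «Passing to the limit as b → 0», p. 19] -/
def Step4_bLimit : Prop :=
  ∀ (Z₁ Z E₁ E : ℝ), 0 < Z₁ → 0 < Z → 0 < E₁ → 0 < E →
    (∀ b : ℝ, 0 < b → Z / Z₁ ≤ (E₁ / E) ^ b) → Z ≤ Z₁

/-- **Step 5 — THEOREM 3.0.1, p. 17 (l.1388–1406), AS PRINTED:** «Let Ω ⊆ ℝ³ be a domain or ℝ³ itself,
and let T > 0. Suppose u : Ω×[0,T) → ℝ³. Assume t ↦ ‖u‖²_{H¹(Ω)} is differentiable on [0,T) and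
satisfies (3.0.1) [d/dt‖u‖²_{L²(Ω)} = −C₀‖∇u‖²_{L²(Ω)}, d/dt‖∇u‖²_{L²(Ω)} ≤ C₁‖∇u‖⁶_{L²(Ω)}, ∀t ∈ [0,T)],
where C₀, C₁ do not depend on T. Then (3.0.2) t ↦ ‖u(·,t)‖²_{H¹(Ω)} is non-increasing on [0,T).» For
every open connected Ω, every horizon `T ∈ (0,∞]`, all constants `C₀, C₁ > 0` and EVERY field `u`
(Navier–Stokes enters only through Cor 3.0.2 / Rem 3.0.3, which verify (3.0.1) for Galerkin / strong
solutions). LOAD-BEARING. Typist's flag: SUSPICIOUS (both relations of (3.0.1) are invariant under the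
scaling (3.0.3); scalar pairs with Z′ = C₁Z³ > 0 are realised by fields A(t)·w(x/L(t))).
[cite: Nguyen2022NSGlobalNoForce, Thm 3.0.1 p. 17] -/
def Step5_Theorem301 : Prop :=
  ∀ (Ω : Set (EuclideanSpace ℝ (Fin 3))), IsOpen Ω → IsConnected Ω →
    ∀ (T : ℝ≥0∞), 0 < T → ∀ (C₀ C₁ : ℝ), 0 < C₀ → 0 < C₁ →
      ∀ u : ℝ → EuclideanSpace ℝ (Fin 3) → EuclideanSpace ℝ (Fin 3),
        Laws301 Ω T C₀ C₁ u → Monotone302 Ω T u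

/-- **Step 5′ — Theorem 3.0.1 at the scalar grain (F15 / TYPING-HYGIENE 13 twin; not in the chain):**
for `T, C₀, C₁ > 0` and ANY positive real functions `E, Z` on [0,T) with `E′ = −C₀Z`, `Z′ ≤ C₁Z³`
(within [0,T)), `E + Z` is non-increasing on [0,T). This is the statement the printed proof (Steps 1–2,
pp. 17–19) actually argues, `u` entering only through `E = ‖u‖₂²`, `Z = ‖∇u‖₂²` and the scaling (3.0.4).
Typist's flag: SUSPICIOUS (e.g. Z′ = C₁Z³ exactly). [cite: Nguyen2022NSGlobalNoForce, Thm 3.0.1 p. 17 and its proof pp. 17–19] -/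
def Step5_Theorem301_scalar : Prop :=
  ∀ (T C₀ C₁ : ℝ) (E Z : ℝ → ℝ), 0 < T → 0 < C₀ → 0 < C₁ → ScalarLaws T C₀ C₁ E Z →
    AntitoneOn (fun t => E t + Z t) (Set.Ico 0 T)

/-- **Step 6 — §4 «Proof of Theorem 1.0.1», Steps A–C, pp. 20–23 (l.1630–1866), as the paper's asserted
implication from Theorem 3.0.1:** Step A (p. 20–21): approximate the datum (4.0.2), solve the Galerkin
systems (4.0.4) on balls B_k (Lemma 2.2.3, pp. 3–4: global Galerkin solutions with the laws
(2.2.10)–(2.2.11)), «Applying Corollary 3.0.2 [= Theorem 3.0.1 for Galerkin solutions, p. 20] for the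
systems (4.0.4)» ⇒ (4.0.6) uniform L^∞ₜH¹ bounds ⇒ Theorem 2.3.8 (p. 13) ⇒ (4.0.10) «u is a unique
global strong solution»; Steps B–C (pp. 21–23): uniform H^{2m+2} bounds ⇒ u, p ∈ C^∞(ℝ³×[0,∞)), the
equations (1.0.3)–(1.0.5) on [0,∞), uniqueness (1.0.7), pressure uniqueness (1.0.8). Typed: Theorem 3.0.1
⇒ for every ν > 0 and every datum of class (1.0.2), some (u, p) satisfies (1.0.3)–(1.0.8) AND has H¹
norm bounded on compact time intervals (the strong class, (4.0.10)). Typist's flag: plausible GIVEN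
Theorem 3.0.1 (classical Galerkin compactness and parabolic regularity; not re-derived here).
[cite: Nguyen2022NSGlobalNoForce, §4 Steps A–C pp. 20–23; Cor 3.0.2 p. 20; Thm 2.3.8 p. 13] -/
def Step6_Section4 : Prop :=
  Step5_Theorem301 →
    ∀ ν : ℝ, 0 < ν →
      ∀ u₀ : EuclideanSpace ℝ (Fin 3) → EuclideanSpace ℝ (Fin 3), DataClass u₀ →
        ∃ (u : ℝ → EuclideanSpace ℝ (Fin 3) → EuclideanSpace ℝ (Fin 3))
          (p : ℝ → EuclideanSpace ℝ (Fin 3) → ℝ),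
          IsClassicalNSSolutionOn (Set.Ici 0) ν 0 u p ∧ u 0 = u₀ ∧ UniqueInStrongClass ν u₀ u ∧
            PressureUniqueUpToConstant ν u p ∧
            ∀ T : ℝ, 0 < T → ∃ C : ℝ≥0∞, C < ∞ ∧ ∀ t ∈ Set.Icc 0 T, h1Sq (u t) ≤ C

/-- **Step 7 — Remark 3.0.3 (1), p. 20 (l.1615) with Lemma 2.2.3 (2.2.10)–(2.2.11), p. 4 (l.323–329):**
«By Robinson [12, Chapter 6], a … strong solution u exists and satisfies the condition (3.0.1) in
Theorem 3.0.1» — used on p. 23 (l.1868) as «By Remark 3.0.3-(1), one gets (1.0.9)»: every classical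
solution of the unforced system on ℝ³ × [0,∞) whose H¹ norm is bounded on compact time intervals
satisfies (3.0.1) on every [0,T) with `C₀ = 2ν` (energy equality) and some `C₁ > 0` (enstrophy
inequality `d/dt‖∇u‖₂² ≤ cν⁻³‖∇u‖₂⁶`). Not a claim of the paper: classical (Robinson–Rodrigo–Sadowski
2016, Ch. 6). Typist's flag: classical. [cite: Nguyen2022NSGlobalNoForce, Remark 3.0.3 (1) p. 20; Lemma 2.2.3 (2.2.10)–(2.2.11) p. 4; p. 23 l.1868] -/
def Step7_StrongSolutionLaws : Prop :=
  ∀ ν : ℝ, 0 < ν → ∃ C₁ : ℝ, 0 < C₁ ∧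
    ∀ (u : ℝ → EuclideanSpace ℝ (Fin 3) → EuclideanSpace ℝ (Fin 3)) (p : ℝ → EuclideanSpace ℝ (Fin 3) → ℝ),
      IsClassicalNSSolutionOn (Set.Ici 0) ν 0 u p →
        (∀ T : ℝ, 0 < T → ∃ C : ℝ≥0∞, C < ∞ ∧ ∀ t ∈ Set.Icc 0 T, h1Sq (u t) ≤ C) →
          ∀ T : ℝ, 0 < T → Laws301 Set.univ (ENNReal.ofReal T) (2 * ν) C₁ u

/-! ## §D. Compositions -/

/-- **The printed proof of Theorem 3.0.1 composes at the scalar grain once Step 3 is granted**: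
Steps 1–4 ⇒ the scalar Theorem 3.0.1 (pp. 17–19: fix t₁ ≤ t; Step 2 gives (3.0.10) for all λ, b;
Step 3 gives Z(t)/Z(t₁) ≤ (E(t₁)/E(t))^b for all b; Step 4 gives Z(t) ≤ Z(t₁); E is non-increasing by the
first relation; hence E + Z is non-increasing). Step 1 is consumed by Step 2 in the paper and enters here
only through it (underscored). [cite: Nguyen2022NSGlobalNoForce, proof of Thm 3.0.1 pp. 17–19] -/
theorem theorem301_scalar_of_steps (_h1 : Step1_PhiDecreasing) (h2 : Step2_RescaledInequality)
    (h3 : Step3_LambdaLimit) (h4 : Step4_bLimit) : Step5_Theorem301_scalar := by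
  intro T C₀ C₁ E Z hT hC₀ hC₁ hlaws
  -- E is non-increasing on [0,T): derivative −C₀ Z ≤ 0 within the interval
  have hE : AntitoneOn E (Set.Ico 0 T) := by
    have hconv : Convex ℝ (Set.Ico (0 : ℝ) T) := convex_Ico 0 T
    refine antitoneOn_of_hasDerivWithinAt_nonpos (f' := fun t => -C₀ * Z t) hconv ?_ ?_ ?_
    · intro t ht
      exact (hlaws t ht).2.2.1.continuousWithinAt
    · intro t ht
      have ht' : t ∈ Set.Ico (0 : ℝ) T := interior_subset ht
      exact ((hlaws t ht').2.2.1.mono interior_subset)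
    · intro t ht
      have ht' : t ∈ Set.Ico (0 : ℝ) T := interior_subset ht
      have hZ : 0 < Z t := (hlaws t ht').2.1
      show -C₀ * Z t ≤ 0
      nlinarith
  intro t₁ ht₁ t ht hle
  have ht₁T : t ∈ Set.Ico t₁ T := ⟨hle, ht.2⟩
  have hE₁ : 0 < E t₁ := (hlaws t₁ ht₁).1
  have hEt : 0 < E t := (hlaws t ht).1
  have hZ₁ : 0 < Z t₁ := (hlaws t₁ ht₁).2.1
  have hZt : 0 < Z t := (hlaws t ht).2.1
  -- Step 2 then Step 3: Z t / Z t₁ ≤ (E t₁ / E t)^b for every b > 0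
  have hb : ∀ b : ℝ, 0 < b → Z t / Z t₁ ≤ (E t₁ / E t) ^ b := fun b hb =>
    h3 (Z t₁) (Z t) (E t₁) (E t) b C₀ C₁ hZ₁ hZt hE₁ hEt hb hC₀ hC₁
      (fun lam hl0 hl1 => h2 T C₀ C₁ E Z hT hC₀ hC₁ hlaws t₁ ht₁ t ht₁T b hb lam hl0 hl1)
  -- Step 4: Z t ≤ Z t₁
  have hZle : Z t ≤ Z t₁ := h4 (Z t₁) (Z t) (E t₁) (E t) hZ₁ hZt hE₁ hEt hb
  have hEle : E t ≤ E t₁ := hE ht₁ ht hle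
  exact add_le_add hEle hZle

/-- **COMPOSITION (kernel): the paper's logic composes.** From Steps 1–7 (ordered index) to Theorem 1.0.1:
Step 6 applied to Step 5 gives `(u, p)` with (1.0.3)–(1.0.8) in the strong class; Step 7 gives (3.0.1)
for `u` on every [0,T) with C₀ = 2ν; Step 5 with Ω = ℝ³ gives (3.0.2) on every [0,T), i.e. (1.0.9) on
[0,∞) («By Remark 3.0.3-(1), one gets (1.0.9)», p. 23). Steps 1–4 are the printed proof of Step 5
(support; `theorem301_scalar_of_steps`) and are not consumed (underscored). Nothing here asserts any
step. [cite: Nguyen2022NSGlobalNoForce, Thm 1.0.1 p. 2; §4 pp. 20–23; p. 23 l.1868] -/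
theorem claim_of_steps (_h1 : Step1_PhiDecreasing) (_h2 : Step2_RescaledInequality)
    (_h3 : Step3_LambdaLimit) (_h4 : Step4_bLimit) (h5 : Step5_Theorem301) (h6 : Step6_Section4)
    (h7 : Step7_StrongSolutionLaws) : ClaimedTheorem := by
  intro ν hν u₀ hu₀
  obtain ⟨u, p, hcl, h0, huniq, hp, hH1⟩ := h6 h5 ν hν u₀ hu₀
  obtain ⟨C₁, hC₁, hlaws⟩ := h7 ν hν
  refine ⟨u, p, hcl, h0, huniq, hp, ?_⟩
  -- (1.0.9): antitone on [0,∞) from antitone on every [0,T)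
  intro s hs t ht hst
  have hT : 0 < t + 1 := by
    have : (0 : ℝ) ≤ t := ht
    linarith
  have hmono : Monotone302 Set.univ (ENNReal.ofReal (t + 1)) u :=
    h5 Set.univ isOpen_univ isConnected_univ (ENNReal.ofReal (t + 1)) (by simpa using hT) (2 * ν) C₁
      (by linarith) hC₁ u (hlaws u p hcl hH1 (t + 1) hT)
  have hs' : s ∈ {r : ℝ | 0 ≤ r ∧ ENNReal.ofReal r < ENNReal.ofReal (t + 1)} :=
    ⟨hs, (ENNReal.ofReal_lt_ofReal_iff hT).mpr (by linarith)⟩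
  have ht' : t ∈ {r : ℝ | 0 ≤ r ∧ ENNReal.ofReal r < ENNReal.ofReal (t + 1)} :=
    ⟨ht, (ENNReal.ofReal_lt_ofReal_iff hT).mpr (by linarith)⟩
  exact hmono hs' ht' hst

/-! ## Rev (typist-5 g5, D-0026 debt pass) — Steps 1, 2, 3′, 4 hold as typed (nothing above changed)

Scalar-grain certificates for the support steps of the proof of Theorem 3.0.1 (pp.17–19): the two
limit passages of p.19 (`step3_LambdaLimit_mConst_holds`, `step4_bLimit_holds`), the decreasing
property of `φ` (`step1_PhiDecreasing_holds`) and the rescaled inequality (3.0.10)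
(`step2_of_step1`, `step2_RescaledInequality_holds`). No statement above is touched; the locator of
record (#26: `Step5_Theorem301`, false lemma) is untouched. -/

/-- **Step 3′ HOLDS** (the λ-constant reading of «Passing to the limit as λ → 0», p.19): for
`Z₁, Z, m > 0`, `λ ↦ (λ + m/Z₁)/(λ + m/Z)` is continuous at `λ = 0` with value `(m/Z₁)/(m/Z) = Z/Z₁`,
so a bound `≤ r` on `(0,1)` passes to the limit (`le_of_tendsto` along `𝓝[>] 0`).
[cite: Nguyen2022NSGlobalNoForce, proof of Thm 3.0.1 Step 2, p. 19] -/
theorem step3_LambdaLimit_mConst_holds : Step3_LambdaLimit_mConst := by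
  intro Z₁ Z m r hZ₁ hZ hm h
  have hden : (0 : ℝ) + m / Z ≠ 0 := by positivity
  -- continuity of the quotient at `λ = 0`
  have hcont : Tendsto (fun lam : ℝ => (lam + m / Z₁) / (lam + m / Z)) (𝓝[>] 0)
      (𝓝 ((0 + m / Z₁) / (0 + m / Z))) := by
    have hc : ContinuousAt (fun lam : ℝ => (lam + m / Z₁) / (lam + m / Z)) 0 :=
      ((continuous_id.add continuous_const).continuousAt).div
        ((continuous_id.add continuous_const).continuousAt) hden
    exact hc.tendsto.mono_left nhdsWithin_le_nhds
  have hval : (0 + m / Z₁) / (0 + m / Z) = Z / Z₁ := by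
    field_simp
    ring
  rw [hval] at hcont
  refine le_of_tendsto hcont ?_
  have hmem : Ioo (0 : ℝ) 1 ∈ 𝓝[>] (0 : ℝ) := Ioo_mem_nhdsGT one_pos
  filter_upwards [hmem] with lam hlam
  exact h lam hlam.1 hlam.2

/-- **Step 4 HOLDS** («Passing to the limit as b → 0, one obtains ‖∇u(t)‖₂²/‖∇u(t₁)‖₂² ≤ 1», p.19):
for `E₁, E > 0` the map `b ↦ (E₁/E)^b` is continuous at `b = 0` with value `1`, so
`Z/Z₁ ≤ (E₁/E)^b` for all `b > 0` gives `Z/Z₁ ≤ 1`, i.e. `Z ≤ Z₁` (`Z₁ > 0`).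
[cite: Nguyen2022NSGlobalNoForce, proof of Thm 3.0.1 Step 2, «Passing to the limit as b → 0», p. 19] -/
theorem step4_bLimit_holds : Step4_bLimit := by
  intro Z₁ Z E₁ E hZ₁ hZ hE₁ hE h
  have hq : 0 < E₁ / E := div_pos hE₁ hE
  have hcont : Tendsto (fun b : ℝ => (E₁ / E) ^ b) (𝓝[>] 0) (𝓝 ((E₁ / E) ^ (0 : ℝ))) :=
    ((Real.continuousAt_const_rpow hq.ne').tendsto).mono_left nhdsWithin_le_nhds
  rw [Real.rpow_zero] at hcont
  have hle : Z / Z₁ ≤ 1 := by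
    refine ge_of_tendsto hcont ?_
    filter_upwards [self_mem_nhdsWithin] with b hb
    exact h b hb
  rwa [div_le_one hZ₁] at hle

/-- **Step 1 HOLDS at the scalar grain** (proof of Thm 3.0.1, Step 1 «Proof of the decreasing
property of φ», (3.0.6)–(3.0.8) pp.17–18): with `m = C₀b/(2C₁E(t₁))`,
`φ = E^b/(1 + m/Z) = E^b Z/(Z + m)` has, within `[t₁,T′)`,
`φ′ = −bC₀E^{b−1}Z²/(Z+m) + mE^bZ′/(Z+m)² ≤ E^{b−1}Z²/(Z+m)·(−bC₀ + C₁mE·Z/(Z+m)) < 0`, because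
`E` is non-increasing (`E′ = −C₀Z < 0`, so `E ≤ E(t₁)` on `[t₁,T′)`) and `Z/(Z+m) < 1` make
`C₁mE·Z/(Z+m) < C₁mE(t₁) = bC₀/2`; a negative derivative on the interior of the interval gives strict
decrease (`strictAntiOn_of_deriv_neg`). [cite: Nguyen2022NSGlobalNoForce, proof of Thm 3.0.1 Step 1, (3.0.6)–(3.0.8) pp. 17–18] -/
theorem step1_PhiDecreasing_holds : Step1_PhiDecreasing := by
  intro t₁ T' C₀ C₁ b E Z hT hC₀ hC₁ hb H
  set S : Set ℝ := Set.Ico t₁ T' with hS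
  set m : ℝ := C₀ * b / (2 * C₁ * E t₁) with hm
  have ht₁S : t₁ ∈ S := ⟨le_rfl, hT⟩
  have hEpos : ∀ t ∈ S, 0 < E t := fun t ht => (H t ht).1
  have hZpos : ∀ t ∈ S, 0 < Z t := fun t ht => (H t ht).2.1
  have hm_pos : 0 < m := by
    have := hEpos t₁ ht₁S
    positivity
  -- `E` is continuous and non-increasing on `S`
  have hEcont : ContinuousOn E S := fun t ht => (H t ht).2.2.1.continuousWithinAt
  have hZcont : ContinuousOn Z S := fun t ht => by
    obtain ⟨z', hz', -⟩ := (H t ht).2.2.2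
    exact hz'.continuousWithinAt
  have hint : interior S = Set.Ioo t₁ T' := by rw [hS, interior_Ico]
  have hIcoNhds : ∀ x ∈ Set.Ioo t₁ T', S ∈ 𝓝 x := fun x hx =>
    mem_of_superset (Ioo_mem_nhds hx.1 hx.2) Set.Ioo_subset_Ico_self
  have hEanti : AntitoneOn E S := by
    refine antitoneOn_of_deriv_nonpos (convex_Ico _ _) hEcont ?_ ?_
    · intro x hx
      rw [hint] at hx
      exact (((H x (Set.Ioo_subset_Ico_self hx)).2.2.1.hasDerivAt
        (hIcoNhds x hx)).differentiableAt).differentiableWithinAt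
    · intro x hx
      rw [hint] at hx
      have hd := (H x (Set.Ioo_subset_Ico_self hx)).2.2.1.hasDerivAt (hIcoNhds x hx)
      rw [hd.deriv]
      have := hZpos x (Set.Ioo_subset_Ico_self hx)
      nlinarith
  -- the derivative of `φ` within `S` and its sign
  have hderiv : ∀ t ∈ S, ∃ φ' : ℝ, HasDerivWithinAt (phi b m E Z) φ' S t ∧ φ' < 0 := by
    intro t ht
    obtain ⟨hEt, hZt, hE', z', hZ', hz'⟩ := H t ht
    have hZm : 0 < Z t + m := by positivity
    -- rewrite `φ = E^b * (Z / (Z + m))` near `t` within `S` (where `Z > 0`)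
    have hφeq : ∀ s ∈ S, phi b m E Z s = E s ^ b * (Z s / (Z s + m)) := by
      intro s hs
      have hZs := hZpos s hs
      have hZsm : Z s + m ≠ 0 := by positivity
      simp only [phi]
      field_simp
    -- derivative of `E^b`
    have h1 : HasDerivWithinAt (fun s => E s ^ b) (b * E t ^ (b - 1) * (-C₀ * Z t)) S t := by
      have := hE'.rpow_const (p := b) (Or.inl hEt.ne')
      simpa [mul_comm, mul_assoc, mul_left_comm] using this
    -- derivative of `Z/(Z+m)`
    have h2 : HasDerivWithinAt (fun s => Z s / (Z s + m))
        ((z' * (Z t + m) - Z t * z') / (Z t + m) ^ 2) S t :=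
      hZ'.div (hZ'.add_const m) hZm.ne'
    have h3 := h1.mul h2
    have h4 : HasDerivWithinAt (phi b m E Z)
        (b * E t ^ (b - 1) * (-C₀ * Z t) * (Z t / (Z t + m)) +
          E t ^ b * ((z' * (Z t + m) - Z t * z') / (Z t + m) ^ 2)) S t :=
      h3.congr (fun s hs => hφeq s hs) (hφeq t ht)
    refine ⟨_, h4, ?_⟩
    -- sign: `E t ≤ E t₁`, `z' ≤ C₁ Z³`, `Z/(Z+m) < 1`
    have hEle : E t ≤ E t₁ := hEanti ht₁S ht ht.1
    have hEb : 0 < E t ^ b := Real.rpow_pos_of_pos hEt b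
    have hEb1 : 0 < E t ^ (b - 1) := Real.rpow_pos_of_pos hEt (b - 1)
    have hEsplit : E t ^ b = E t ^ (b - 1) * E t := by
      rw [← Real.rpow_add_one hEt.ne' (b - 1)]; ring_nf
    have hnum : z' * (Z t + m) - Z t * z' = m * z' := by ring
    rw [hnum, hEsplit]
    -- reduce to the bracket `−bC₀ Z²/(Z+m) + E m z'/(Z+m)² < 0`
    have hz'le : m * z' ≤ m * (C₁ * Z t ^ 3) := mul_le_mul_of_nonneg_left hz' hm_pos.le
    have hkey : E t * (m * (C₁ * Z t ^ 3)) / (Z t + m) ^ 2 <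
        b * C₀ * Z t * (Z t / (Z t + m)) := by
      -- `E t * m * C₁ ≤ E t₁ * m * C₁ = C₀ b / 2` and `Z/(Z+m) < 1`
      have hmE : E t * m * C₁ ≤ C₀ * b / 2 := by
        have h' : E t₁ * m * C₁ = C₀ * b / 2 := by
          have hE1 : E t₁ ≠ 0 := (hEpos t₁ ht₁S).ne'
          rw [hm]; field_simp
        calc E t * m * C₁ ≤ E t₁ * m * C₁ := by
              have : 0 ≤ m * C₁ := by positivity
              nlinarith
          _ = C₀ * b / 2 := h'
      have hfrac : Z t / (Z t + m) < 1 := by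
        rw [div_lt_one hZm]; linarith
      have hfrac_pos : 0 < Z t / (Z t + m) := div_pos hZt hZm
      have hlhs : E t * (m * (C₁ * Z t ^ 3)) / (Z t + m) ^ 2 =
          (E t * m * C₁) * Z t * (Z t / (Z t + m)) * (Z t / (Z t + m)) := by
        field_simp
      rw [hlhs]
      have hA : (E t * m * C₁) * Z t * (Z t / (Z t + m)) * (Z t / (Z t + m)) <
          (E t * m * C₁) * Z t * (Z t / (Z t + m)) * 1 + (C₀ * b / 2) * Z t * (Z t / (Z t + m)) := by
        have h0 : 0 ≤ (E t * m * C₁) * Z t * (Z t / (Z t + m)) := by positivity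
        have h00 : 0 < (C₀ * b / 2) * Z t * (Z t / (Z t + m)) := by positivity
        nlinarith [mul_le_mul_of_nonneg_left hfrac.le h0]
      have hB : (E t * m * C₁) * Z t * (Z t / (Z t + m)) * 1 + (C₀ * b / 2) * Z t * (Z t / (Z t + m)) ≤
          b * C₀ * Z t * (Z t / (Z t + m)) := by
        have h0 : 0 ≤ Z t * (Z t / (Z t + m)) := by positivity
        nlinarith [mul_le_mul_of_nonneg_right hmE h0]
      linarith
    have hstep : E t ^ (b - 1) * E t * (m * z' / (Z t + m) ^ 2) ≤
        E t ^ (b - 1) * (E t * (m * (C₁ * Z t ^ 3)) / (Z t + m) ^ 2) := by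
      have hsq : 0 < (Z t + m) ^ 2 := by positivity
      have : E t * (m * z' / (Z t + m) ^ 2) ≤ E t * (m * (C₁ * Z t ^ 3)) / (Z t + m) ^ 2 := by
        rw [mul_div_assoc']
        exact div_le_div_of_nonneg_right (mul_le_mul_of_nonneg_left hz'le hEt.le) hsq.le
      calc E t ^ (b - 1) * E t * (m * z' / (Z t + m) ^ 2)
          = E t ^ (b - 1) * (E t * (m * z' / (Z t + m) ^ 2)) := by ring
        _ ≤ E t ^ (b - 1) * (E t * (m * (C₁ * Z t ^ 3)) / (Z t + m) ^ 2) :=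
          mul_le_mul_of_nonneg_left this hEb1.le
    calc b * E t ^ (b - 1) * (-C₀ * Z t) * (Z t / (Z t + m)) +
          E t ^ (b - 1) * E t * (m * z' / (Z t + m) ^ 2)
        ≤ b * E t ^ (b - 1) * (-C₀ * Z t) * (Z t / (Z t + m)) +
          E t ^ (b - 1) * (E t * (m * (C₁ * Z t ^ 3)) / (Z t + m) ^ 2) := by linarith
      _ = E t ^ (b - 1) * (E t * (m * (C₁ * Z t ^ 3)) / (Z t + m) ^ 2 -
          b * C₀ * Z t * (Z t / (Z t + m))) := by ring
      _ < 0 := mul_neg_of_pos_of_neg hEb1 (by linarith)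
  -- continuity and strict decrease on `S`
  have hφcont : ContinuousOn (phi b m E Z) S := fun t ht => by
    obtain ⟨φ', hφ', -⟩ := hderiv t ht
    exact hφ'.continuousWithinAt
  refine strictAntiOn_of_deriv_neg (convex_Ico _ _) hφcont fun x hx => ?_
  rw [hint] at hx
  obtain ⟨φ', hφ', hneg⟩ := hderiv x (Set.Ioo_subset_Ico_self hx)
  rw [(hφ'.hasDerivAt (hIcoNhds x hx)).deriv]
  exact hneg

/-- **Step 2 follows from Step 1 at the scalar grain** ((3.0.9)–(3.0.10) p.19): for `λ > 0` the
factor `λ` cancels in the left member of (3.0.10) with the printed `m = λ·C₀b/(2C₁E(t₁))`, leaving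
`(1 + m₀/Z(t₁))/(1 + m₀/Z(t)) ≤ (E(t₁)/E(t))^b`, `m₀ = C₀b/(2C₁E(t₁))` — which is `φ(t) ≤ φ(t₁)` for the
decreasing `φ` of Step 1 on `[t₁,T)` (the laws (3.0.1) on `[0,T)` restrict to `[t₁,T)`).
[cite: Nguyen2022NSGlobalNoForce, (3.0.9)–(3.0.10) p. 19] -/
theorem step2_of_step1 (h1 : Step1_PhiDecreasing) : Step2_RescaledInequality := by
  intro T C₀ C₁ E Z hT hC₀ hC₁ hlaws t₁ ht₁ t ht b hb lam hlam _
  -- restrict the laws (3.0.1) to `[t₁, T)`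
  have hsub : Set.Ico t₁ T ⊆ Set.Ico 0 T := fun s hs => ⟨ht₁.1.trans hs.1, hs.2⟩
  have H : ∀ s ∈ Set.Ico t₁ T, 0 < E s ∧ 0 < Z s ∧
      HasDerivWithinAt E (-C₀ * Z s) (Set.Ico t₁ T) s ∧
        ∃ z' : ℝ, HasDerivWithinAt Z z' (Set.Ico t₁ T) s ∧ z' ≤ C₁ * Z s ^ 3 := by
    intro s hs
    obtain ⟨hE, hZ, hE', z', hZ', hz'⟩ := hlaws s (hsub hs)
    exact ⟨hE, hZ, hE'.mono hsub, z', hZ'.mono hsub, hz'⟩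
  have ht₁T : t₁ < T := lt_of_le_of_lt ht.1 ht.2
  have hanti := h1 t₁ T C₀ C₁ b E Z ht₁T hC₀ hC₁ hb H
  have hφle : phi b (C₀ * b / (2 * C₁ * E t₁)) E Z t ≤ phi b (C₀ * b / (2 * C₁ * E t₁)) E Z t₁ :=
    hanti.antitoneOn ⟨le_rfl, ht₁T⟩ ht ht.1
  obtain ⟨hE₁, hZ₁, -⟩ := hlaws t₁ ht₁
  obtain ⟨hEt, hZt, -⟩ := hlaws t (hsub ht)
  set m₀ : ℝ := C₀ * b / (2 * C₁ * E t₁) with hm₀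
  have hm₀pos : 0 < m₀ := by positivity
  have hL : (lam + lam * m₀ / Z t₁) / (lam + lam * m₀ / Z t) = (1 + m₀ / Z t₁) / (1 + m₀ / Z t) := by
    have h1' : lam + lam * m₀ / Z t₁ = lam * (1 + m₀ / Z t₁) := by ring
    have h2' : lam + lam * m₀ / Z t = lam * (1 + m₀ / Z t) := by ring
    rw [h1', h2', mul_div_mul_left _ _ hlam.ne']
  rw [hL]
  simp only [phi] at hφle
  have hden1 : 0 < 1 + m₀ / Z t₁ := by positivity
  have hden : 0 < 1 + m₀ / Z t := by positivity
  have hEb : 0 < E t ^ b := Real.rpow_pos_of_pos hEt b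
  have hcross := (div_le_div_iff₀ hden hden1).1 hφle
  rw [div_le_iff₀ hden, Real.div_rpow hE₁.le hEt.le, div_mul_eq_mul_div, le_div_iff₀ hEb]
  linarith [hcross]

/-- **Step 2 HOLDS at the scalar grain** ((3.0.9)–(3.0.10) p.19), from `step1_PhiDecreasing_holds` via
`step2_of_step1`. With Steps 1, 2, 3′, 4 kernel-true, the printed chain of Thm 3.0.1 fails exactly at
the λ-bookkeeping of Step 3 (`Step3_LambdaLimit`, with the PRINTED λ-dependent `m`) and at the printed
Theorem 3.0.1 itself (`Step5_Theorem301`, locator of record #26, kernel-false Summits-side) — record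
unchanged. [cite: Nguyen2022NSGlobalNoForce, (3.0.9)–(3.0.10) p. 19] -/
theorem step2_RescaledInequality_holds : Step2_RescaledInequality :=
  step2_of_step1 step1_PhiDecreasing_holds

end

end Literature.Claims.NS.Nguyen2022
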